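import Summits.QuantumAdvantage.QuantumAdvantage.Theorems.SoloInformedValueLiftReduction
import Literature.Computability.Complexity.ValiantVaziraniReduction
import HarnessLib

/-!
# Q-EXT dichotomy, global form: a `BQP` threshold solver that is not a rounding rule, or
# `NP ⊆ RP^{BQP}` (solo-informed, file 41)

Solo seat `solo-QuantumAdvantage-informed`, session 17 (§4.35 of the seat's paper; sharpens THEOREM N1
of file 30, `SoloInformedValueLiftReduction.lean`).

THEOREM N1 (kernel, file 30) says: if `PromiseBQP ⊆ promiseLift BQP` (Q-EXT: every promise problem in
`PromiseBQP` extends to a LANGUAGE in `BQP`), then for every checker `W ∈ P` the `(7/12, 5/12)`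
threshold problem of the explicit uniform family `affFamily hW` has a `BQP` solution `L`, and either `L`
is not value-determined at some `(u, d)` or unique-`W` (`uniqueSAT W`: exactly one / no witness of
length `|u|` for `d`) is in `promise-P^BQP`.  This file feeds the second branch into the tree's
Valiant–Vazirani reduction in oracle form (`Literature/Computability/Complexity/ValiantVaziraniReduction.lean`,
`ValiantVazirani.NP_subset_rp_PRelClass`: if the unique-witness promise problems of the HASHED `P`
relations are solved by `promiseLift C` then `NP ⊆ rp (P^C)`), obtaining the GLOBAL DICHOTOMY

  `QEXT_dichotomy_NP`:  Q-EXT ⟹ (∃ W ∈ P, ∃ L ∈ BQP solving Thr(affFamily W) and NOT value-determined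
                        at some (u, d))  ∨  NP ⊆ rp (P^BQP).

Equivalently (`NP_subset_rp_PRelBQP_of_QEXT`): if Q-EXT holds and every `BQP` solution of every
`Thr(affFamily W)`, `W ∈ P`, is a (local) rounding rule of the acceptance probability, then
`NP ⊆ RP^{BQP}` (and `P^{P^{BQP}} = P^{BQP}`, `PRelClass_PRelClass_subset_self`, absorbs the extra
oracle level of the reduction).  With the classical closure facts `P^{BQP} = BQP` (Bennett–Bernstein–
Brassard–Vazirani 1997, Thm. 4.14) and `R·BQP = BQP` — not in the tree, NOT used — the second branch
reads `NP ⊆ BQP`.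

The format bridge (`swapRel`, `satCount_swapRel`, `uniqueWitness_mem_promiseLift`) transports a
solver of `uniqueSAT (swapRel S)` (witness-first instances `⟨u, d⟩`, count over `X ∈ {0,1}^{|u|}` of
`⟨X, d⟩ ∈ swapRel S`) to a solver of `ValiantVazirani.UniqueWitness S` (instance-first, total parsing)
through one polynomial-time preimage.

Route from here to the summit `BQP ⊄ BPP`: none — like N1 this is a structure theorem about the door
Q-EXT (what a language-extension of `PromiseBQP` must look like), recorded in PLAN.md's door table.
Trust base: Mathlib only (all imported Literature declarations used are definitions or proved theorems).
-/

namespace Summit.QuantumAdvantage.QuantumAdvantage.Theorems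

open _root_.Computability Literature.Computability.Complexity Literature.Computability.Complexity.Classes
  Literature.Computability.Cryptography Literature.Computability.QuantumComplexity Brick
open Literature.Computability.Complexity.ValiantVazirani

namespace QEXTValiantVazirani

/-! ### The format bridge: witness-first `uniqueSAT` versus instance-first `UniqueWitness` -/

/-- The relation with instance and witness swapped: `⟨a, b⟩ ∈ swapRel S ↔ ⟨b, a⟩ ∈ S`. -/
def swapRel (S : Language Bool) : Language Bool := fanoutFn sndF fstF ⁻¹' S

/-- `swapRel S ∈ P` for `S ∈ P`. -/
theorem swapRel_mem_P {S : Language Bool} (hS : S ∈ P) : swapRel S ∈ P :=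
  preimage_mem_P hS (fanoutFn_mem_FP sndF_mem_FP fstF_mem_FP)

/-- Membership in `swapRel`. -/
theorem boolPair_mem_swapRel (S : Language Bool) (a b : List Bool) :
    boolPair a b ∈ swapRel S ↔ boolPair b a ∈ S := by
  rw [swapRel, memL_preimage, fanoutFn_apply, sndF_boolPair, fstF_boolPair]

/-- The `uniqueSAT` count of the swapped relation is the witness count of the relation. -/
theorem satCount_swapRel (S : Language Bool) (u d : List Bool) :
    satCount (swapRel S) u d = countWitnesses S u.length d := by
  classical
  rw [satCount_eq_card]
  unfold countWitnesses
  exact congrArg Finset.card (Finset.filter_congr fun X _ => boolPair_mem_swapRel S X.toList d)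

/-- **Transport**: a `promiseLift K` solution of `uniqueSAT (swapRel S)` yields one of
`UniqueWitness S`, for `K` closed under polynomial-time preimages. -/
theorem uniqueWitness_mem_promiseLift {K : Set (Language Bool)}
    (hK : ∀ ⦃L : Language Bool⦄, L ∈ K → ∀ ⦃g : List Bool → List Bool⦄, g ∈ FP → g ⁻¹' L ∈ K)
    {S : Language Bool} (h : uniqueSAT (swapRel S) ∈ promiseLift K) :
    UniqueWitness S ∈ promiseLift K := by
  obtain ⟨L, hL, hY, hN⟩ := h
  refine ⟨fanoutFn sndF fstF ⁻¹' L, hK hL (fanoutFn_mem_FP sndF_mem_FP fstF_mem_FP),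
    fun z hz => ?_, fun z hz hzL => ?_⟩
  · have hz' : boolPair (sndF z) (fstF z) ∈ (uniqueSAT (swapRel S)).yes :=
      ⟨sndF z, fstF z, rfl, by rw [satCount_swapRel]; exact hz⟩
    have h1 : fanoutFn sndF fstF z ∈ L := by rw [fanoutFn_apply]; exact hY hz'
    exact memL_preimage.2 h1
  · have hz' : boolPair (sndF z) (fstF z) ∈ (uniqueSAT (swapRel S)).no :=
      ⟨sndF z, fstF z, rfl, by rw [satCount_swapRel]; exact hz⟩
    have h1 : fanoutFn sndF fstF z ∈ L := memL_preimage.1 hzL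
    rw [fanoutFn_apply] at h1
    exact hN hz' h1

/-- **Valiant–Vazirani on the `uniqueSAT` format**: if unique-`W` is solved by `promiseLift K` for every
checker `W ∈ P` (`K` closed under polynomial-time preimages), then `NP ⊆ rp (P^K)`. -/
theorem NP_subset_rp_of_uniqueSAT {K : Set (Language Bool)}
    (hK : ∀ ⦃L : Language Bool⦄, L ∈ K → ∀ ⦃g : List Bool → List Bool⦄, g ∈ FP → g ⁻¹' L ∈ K)
    (hU : ∀ W ∈ P, uniqueSAT W ∈ promiseLift K) : Nondeterministic.NP ⊆ rp (PRelClass K) :=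
  NP_subset_rp_PRelClass fun _ hR =>
    uniqueWitness_mem_promiseLift hK (hU _ (swapRel_mem_P (hashRel_mem_P hR)))

/-! ### The global dichotomy under Q-EXT -/

/-- **If Q-EXT holds and every forced `BQP` threshold solver is a local rounding rule, then
`NP ⊆ RP^{BQP}`.** -/
theorem NP_subset_rp_PRelBQP_of_QEXT (hExt : PromiseBQP ⊆ promiseLift BQP)
    (hV : ∀ (W : Language Bool) (hW : W ∈ P) (L : Language Bool), L ∈ BQP →
      (thresholdProblem (affFamily hW)).yes ≤ L → (thresholdProblem (affFamily hW)).no ≤ Lᶜ →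
        ∀ u d, ValueDeterminedAt (affFamily hW) L u d) :
    Nondeterministic.NP ⊆ rp (PRelClass BQP) := by
  have hU : ∀ W ∈ P, uniqueSAT W ∈ promiseLift (PRelClass BQP) := fun W hW => by
    obtain ⟨L, hL, hY, hN, h⟩ := QEXT_valueDetermined_dichotomy hExt hW
    rcases h with ⟨u, d, hud⟩ | h
    · exact absurd (hV W hW L hL hY hN u d) hud
    · exact h
  exact (NP_subset_rp_of_uniqueSAT (fun _ hM _ hg => preimage_mem_PRelClass hM hg) hU).trans
    (rp_mono (PRelClass_PRelClass_subset_self BQP))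

/-- **THE GLOBAL DICHOTOMY UNDER Q-EXT.** If `PromiseBQP ⊆ promiseLift BQP` then EITHER some checker
`W ∈ P` has a `BQP` solution of `Thr(affFamily hW)` that separates a comparison instance from a probe
instance with the same `(u, d)` and the same acceptance probability (a `BQP` language reading more than
the value), OR `NP ⊆ rp (P^BQP)`. -/
theorem QEXT_dichotomy_NP (hExt : PromiseBQP ⊆ promiseLift BQP) :
    (∃ (W : Language Bool) (hW : W ∈ P), ∃ L ∈ BQP,
        (thresholdProblem (affFamily hW)).yes ≤ L ∧ (thresholdProblem (affFamily hW)).no ≤ Lᶜ ∧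
          ∃ u d, ¬ ValueDeterminedAt (affFamily hW) L u d) ∨
      Nondeterministic.NP ⊆ rp (PRelClass BQP) := by
  by_cases hA : ∃ (W : Language Bool) (hW : W ∈ P), ∃ L ∈ BQP,
      (thresholdProblem (affFamily hW)).yes ≤ L ∧ (thresholdProblem (affFamily hW)).no ≤ Lᶜ ∧
        ∃ u d, ¬ ValueDeterminedAt (affFamily hW) L u d
  · exact Or.inl hA
  · refine Or.inr (NP_subset_rp_PRelBQP_of_QEXT hExt fun W hW L hL hY hN u d => ?_)
    by_contra hud
    exact hA ⟨W, hW, L, hL, hY, hN, u, d, hud⟩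

end QEXTValiantVazirani

end Summit.QuantumAdvantage.QuantumAdvantage.Theorems
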